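import Mathlib
import HarnessLib
import Literature.Probability.LatticeModels.ProductTorusCharSumYoung
import Literature.Probability.LatticeModels.TorusBlockFourier
import Summits.HubbardSuperconductivity.HubbardSuperconductivity.Theorems.KLProgrammeH10TwoPointLimitSectorMultiplierFat
import Summits.HubbardSuperconductivity.HubbardSuperconductivity.Theorems.KLProgrammeKLRegimeEngineNormsStepDoor

/-!
# Route `KLProgramme` — ENGINE item stmt-HubbardSuperconductivity-20437, class #6 (`IsoTupleLineAt`, (X).2 conjunct) PRODUCER SIDE:
# the ISO(m) × FAT(n₂) pair of multipliers reduces to ISO × THIN and to the two SINGLE character sums (symbol/count layer of the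
# iso ← thin single-tuple re-sectorisation)

Cell gate-hubbard-kl, seat hubbard-kl-k3c2-p2 (g10; class-#6 text owner `…EngineV8IsoTupleExportW`, (E5-F)ₙ door).  The class-#6 line
`IsoTupleLineAt … n` is the fixed-tuple `L¹` size of the scale-`n` quartic kernel sectorised with the ISOTROPIC family of every resolution
`m ≥ n`; every producer of the tree (stub (b)'s tower, the value lane) measures kernels in the THIN (anisotropic) families.  The bridge is
the per-tuple plateau-pair re-sectorisation `Literature…SectorisedKernelNormRefinementPlateau.hubbardSectorPinnedSum_refine_le_of_plateau_pair`
for the pair (thin `n₂`, fat `n₂` ; iso `m`), `n₂ + 1 ≤ m`; this file supplies its SYMBOL-LAYER inputs, mirroring p4's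
`…H10TwoPointLimitSectorMultiplierFat` (thin × fat) with the first factor isotropic:

* §1 `klIsoFamily_eq_zero_of_le` (the iso multiplier of resolution `m` vanishes at `t ≥ Λ_m`),
  **`sum_klAnisoFamily_eq_one_of_klIsoFamily_ne_zero`** (PLATEAU: for `n₂ + 1 ≤ m` the thin family of index `n₂` sums to `1` on the support
  of every iso multiplier of resolution `m` — radial nesting `Λ_m ≤ Λ_{n₂+1}`, `gnScaleCutoff_eq_one`),
  **`klIsoFamily_mul_bgmFatMultiplier_eq_sum`** (TELESCOPE: `iso_{m,σ}·F̃_{n₂,ω₂} = Σ_{a ∈ S_{ω₂}} iso_{m,σ}·thin_{n₂,a}`, `#S ≤ 3`);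
* §2 **`card_overlap_klIso_bgmFat_coarse_le`** — an iso sector of resolution `m` meets at most `27` fat multipliers of index `n₂ ≤ 2m`
  (p4's `card_coarse_overlap_le` at angular indices `(n₂, 2m)` + `card_fatNbrFin_symm_le_three`);
* §3 character sums (p4's `(ℤ/2M) × (ℤ/L)²` convention): `charSum_klIso_klAniso_le_of_singles` (iso × thin `≤ (2ML²)⁻¹·Tᵢ·Tₐ` from the two
  SINGLE sums, Young on the product torus), `charSum_klIso_bgmFat_le` (iso × fat `≤ 3·T` from iso × thin `≤ T`),
  **`overlap_pairSums_klIso_bgmFat_le_of_singles`** (the per-pair column AND row position sums of `E(klIsoFamily m)·S(F̃_{n₂})` are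
  `≤ 3·(2ML²)⁻¹·Tᵢ·Tₐ/(βL²)` — the `hcol₁/hrow₁` inputs of the per-tuple re-sectorisation);
* §4 **`charSum_l1_le_padded`** — the `(ℤ/2M) × (ℤ/L)²` character-sum `ℓ¹` norm of ANY symbol is at most its `(ℤ/4M) × (ℤ/L)²`-PADDED twin
  (the even sub-lattice `d = 2z₀`, `TorusBlock.torusChar_lift_eq_reduce`), and **`charSum_klIso_single_le_of_padded`**: the iso single sum is
  `≤ 2M·L²·T` from the inner statement of `EngineV8.IsoTorusBoundAt T` (charge `0`) — so the engine's CLOSED constant `klIsoT`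
  (`isoTorusBoundAt_klIsoT`) is the iso single datum, for every resolution `m`.

Everything is proved; no definitions; nothing about the model is asserted beyond these implications.
[cite: BenfattoGiulianiMastropietro2006, §2.5 (2.57), §2.7 (2.66), (2.71)–(2.71a)]
-/

noncomputable section

namespace Summit.HubbardSuperconductivity.HubbardSuperconductivity.Theorems.TorusFourierL2

set_option linter.dupNamespace false -- summit = problem name (single-conjunct summit), D-0017

open Finset Literature.MathematicalPhysics.QuantumLattice Literature.Probability.LatticeModels
open Summit.HubbardSuperconductivity.HubbardSuperconductivity.Theorems.KLProgrammeLegKernels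
open Summit.HubbardSuperconductivity.HubbardSuperconductivity.Theorems.PerturbedFermiCurve
open Summit.HubbardSuperconductivity.HubbardSuperconductivity.Theorems.KLRegimeWick
open Summit.HubbardSuperconductivity.HubbardSuperconductivity.Theorems.EngineV8
open scoped Real

open Classical

variable {L M : ℕ} [NeZero L]

/-! ### §1 Plateau and telescope -/

omit [NeZero L] in
/-- **The iso multiplier of resolution `m` vanishes at `t ≥ Λ_m`** (`t = |{-ik₀} + e_K|`). [cite: BenfattoGiulianiMastropietro2006, §2.5 (2.57)] -/
theorem klIsoFamily_eq_zero_of_le {e₀ : ℝ} (he : 0 < e₀) (β μ : ℝ) (K : TrigPolyC4v) (m : ℕ) (σ : Fin (sectorCount (2 * m)))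
    (k : FreqMomentum L M) (hk : klScale e₀ m ≤ Real.sqrt (matsubaraFreq β M k.1 ^ 2 + nambuXiCT L μ K k.2 ^ 2)) :
    klIsoFamily L M β μ K e₀ m σ k = 0 := by
  rw [klIsoFamily, klIsoMultiplier, gnScaleCutoff_eq_zero (by norm_num) he (by rwa [← klScale_eq_zpow e₀]), zero_mul,
    Complex.ofReal_zero]

omit [NeZero L] in
/-- **PLATEAU: every iso family of resolution `m ≥ n₂ + 1` lives in the plateau of the thin family of index `n₂`**:
`klIsoFamily … m σ k ≠ 0 ⇒ Σ_ω klAnisoFamily … n₂ ω k = 1` (on the support `t < Λ_m ≤ Λ_{n₂+1}` the cutoff `C_{-n₂}⁻¹` is `1`).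
[cite: BenfattoGiulianiMastropietro2006, §2.5 (2.57)] -/
theorem sum_klAnisoFamily_eq_one_of_klIsoFamily_ne_zero {e₀ : ℝ} (he : 0 < e₀) (β μ : ℝ) (K : TrigPolyC4v) {n₂ m : ℕ}
    (hm : n₂ + 1 ≤ m) (σ : Fin (sectorCount (2 * m))) (k : FreqMomentum L M) (h : klIsoFamily L M β μ K e₀ m σ k ≠ 0) :
    ∑ ω, klAnisoFamily L M β μ K e₀ n₂ ω k = 1 := by
  have hlt : Real.sqrt (matsubaraFreq β M k.1 ^ 2 + nambuXiCT L μ K k.2 ^ 2) < klScale e₀ m :=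
    lt_of_not_ge fun hge => h (klIsoFamily_eq_zero_of_le he β μ K m σ k hge)
  exact sum_klAnisoFamily_eq_one_of_le β μ K he n₂ k (hlt.le.trans (klScale_le_klScale he.le hm))

omit [NeZero L] in
/-- **TELESCOPE: iso × fat = Σ iso × thin, pointwise.**  For `n₂ + 1 ≤ m`, every `σ, ω₂` and every frequency–momentum `k`:
`iso_{m,σ}(k) · F̃_{n₂,ω₂}(k) = Σ_{a ∈ S_{ω₂}} iso_{m,σ}(k) · thin_{n₂,a}(k)` — on the support of `C_{-m}⁻¹` the fat radial plateau `C_{-n₂+1}⁻¹`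
and the thin cutoff `C_{-n₂}⁻¹` are both `1`. [cite: BenfattoGiulianiMastropietro2006, §2.7 (2.66)] -/
theorem klIsoFamily_mul_bgmFatMultiplier_eq_sum {e₀ : ℝ} (he : 0 < e₀) (β μ : ℝ) (K : TrigPolyC4v) {m n₂ : ℕ}
    (hm : n₂ + 1 ≤ m) (σ : Fin (sectorCount (2 * m))) (ω₂ : Fin (sectorCount n₂)) (k : FreqMomentum L M) :
    klIsoFamily L M β μ K e₀ m σ k * bgmFatMultiplier L M e₀ β (nambuXiCT L μ K) n₂ ω₂ k =
      ∑ a ∈ (univ : Finset (Fin (sectorCount n₂))).filter (fun a : Fin (sectorCount n₂) =>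
          ∃ δ : ℤ, |δ| ≤ 1 ∧ (sectorCount n₂ : ℤ) ∣ (((a : ℕ) : ℤ) - ((ω₂ : ℕ) : ℤ) - δ)),
        klIsoFamily L M β μ K e₀ m σ k * klAnisoFamily L M β μ K e₀ n₂ a k := by
  set t : ℝ := Real.sqrt (matsubaraFreq β M k.1 ^ 2 + nambuXiCT L μ K k.2 ^ 2) with ht
  set θ : ℝ := momentumAngle L k.2 with hθ
  -- the angular sum over the `Fin`-indexed neighbour set is the `range`-indexed sum of the definition
  have hsum : ∑ a ∈ (univ : Finset (Fin (sectorCount n₂))).filter (fun a : Fin (sectorCount n₂) =>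
        ∃ δ : ℤ, |δ| ≤ 1 ∧ (sectorCount n₂ : ℤ) ∣ (((a : ℕ) : ℤ) - ((ω₂ : ℕ) : ℤ) - δ)),
        sectorWeightCirc n₂ ((a : ℕ) : ℤ) θ =
      ∑ ω' ∈ (range (sectorCount n₂)).filter
        (fun ω' : ℕ => ∃ δ : ℤ, |δ| ≤ 1 ∧ (sectorCount n₂ : ℤ) ∣ ((ω' : ℤ) - ((ω₂ : ℕ) : ℤ) - δ)),
        sectorWeightCirc n₂ ω' θ := by
    rw [Finset.sum_filter, Finset.sum_filter,
      Fin.sum_univ_eq_sum_range (fun i : ℕ => if (∃ δ : ℤ, |δ| ≤ 1 ∧ (sectorCount n₂ : ℤ) ∣ ((i : ℤ) - ((ω₂ : ℕ) : ℤ) - δ))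
        then sectorWeightCirc n₂ (i : ℤ) θ else 0)]
  by_cases hC : gnScaleCutoff 4 e₀ (-(m : ℤ)) t = 0
  · -- off the support of the iso cutoff both sides vanish
    have h1 : klIsoFamily L M β μ K e₀ m σ k = 0 := by
      unfold klIsoFamily klIsoMultiplier; rw [← ht, hC]; simp
    rw [h1, zero_mul]
    exact (Finset.sum_eq_zero fun a _ => by rw [zero_mul]).symm
  · -- on the support: `t < e₀ 4^{-m}`, so both plateaux are `1`
    have hlt : t < e₀ * (4 : ℝ) ^ (-(m : ℤ)) := lt_of_gnScaleCutoff_ne_zero he hC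
    have hmono : (4 : ℝ) ^ (-(m : ℤ)) ≤ (4 : ℝ) ^ (-(n₂ : ℤ) - 1) :=
      zpow_le_zpow_right₀ (by norm_num) (by omega)
    have hle1 : t ≤ e₀ * (4 : ℝ) ^ ((-(n₂ : ℤ) + 1) - 1) := by
      have : (4 : ℝ) ^ (-(m : ℤ)) ≤ (4 : ℝ) ^ ((-(n₂ : ℤ) + 1) - 1) := zpow_le_zpow_right₀ (by norm_num) (by omega)
      exact hlt.le.trans (mul_le_mul_of_nonneg_left this he.le)
    have hle2 : t ≤ e₀ * (4 : ℝ) ^ (-(n₂ : ℤ) - 1) := hlt.le.trans (mul_le_mul_of_nonneg_left hmono he.le)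
    have hfat : gnScaleCutoff 4 e₀ (-(n₂ : ℤ) + 1) t = 1 := gnScaleCutoff_eq_one (by norm_num) he hle1
    have hthin : gnScaleCutoff 4 e₀ (-(n₂ : ℤ)) t = 1 := gnScaleCutoff_eq_one (by norm_num) he hle2
    have h2 : ∀ a : Fin (sectorCount n₂), klAnisoFamily L M β μ K e₀ n₂ a k = (sectorWeightCirc n₂ ((a : ℕ) : ℤ) θ : ℂ) := by
      intro a
      unfold klAnisoFamily bgmMultiplier
      rw [← ht, hthin, one_mul]
    have hF : bgmFatMultiplier L M e₀ β (nambuXiCT L μ K) n₂ ω₂ k =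
        ((∑ a ∈ (univ : Finset (Fin (sectorCount n₂))).filter (fun a : Fin (sectorCount n₂) =>
            ∃ δ : ℤ, |δ| ≤ 1 ∧ (sectorCount n₂ : ℤ) ∣ (((a : ℕ) : ℤ) - ((ω₂ : ℕ) : ℤ) - δ)),
          sectorWeightCirc n₂ ((a : ℕ) : ℤ) θ : ℝ) : ℂ) := by
      unfold bgmFatMultiplier
      rw [← ht, ← hθ, hfat, one_mul, hsum]
    rw [hF]
    simp_rw [h2]
    rw [Complex.ofReal_sum, Finset.mul_sum]

/-! ### §2 The overlap count of the iso × fat pair (coarse side) -/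

/-- **Coarse side**: an iso sector `σ` of resolution `m` meets (common support point) at most `27` fat multipliers of index `n₂ ≤ 2m` —
`≤ 9` coarse thin sectors at angular indices `(n₂, 2m)` (`card_coarse_overlap_le`), each a neighbour of `≤ 3` fat labels.
[cite: BenfattoGiulianiMastropietro2006, §2.7 (2.71a)] -/
theorem card_overlap_klIso_bgmFat_coarse_le {e₀ : ℝ} (he : 0 < e₀) (β μ : ℝ) (K : TrigPolyC4v) {m n₂ : ℕ} (hn : n₂ ≤ 2 * m)
    (σ : Fin (sectorCount (2 * m))) :
    ((univ : Finset (Fin (sectorCount n₂))).filter (fun ω₂ : Fin (sectorCount n₂) =>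
      ∃ k : FreqMomentum L M, klIsoFamily L M β μ K e₀ m σ k ≠ 0 ∧
        bgmFatMultiplier L M e₀ β (nambuXiCT L μ K) n₂ ω₂ k ≠ 0)).card ≤ 27 := by
  -- the coarse thin sectors met by `σ`
  set C := (univ : Finset (Fin (sectorCount n₂))).filter (fun a : Fin (sectorCount n₂) =>
      ∃ θ : ℝ, sectorWeightCirc (2 * m) ((σ : ℕ) : ℤ) θ ≠ 0 ∧ sectorWeightCirc n₂ ((a : ℕ) : ℤ) θ ≠ 0) with hC
  have hCcard : C.card ≤ 9 := card_coarse_overlap_le hn σ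
  have hsub : (univ : Finset (Fin (sectorCount n₂))).filter (fun ω₂ : Fin (sectorCount n₂) =>
      ∃ k : FreqMomentum L M, klIsoFamily L M β μ K e₀ m σ k ≠ 0 ∧
        bgmFatMultiplier L M e₀ β (nambuXiCT L μ K) n₂ ω₂ k ≠ 0) ⊆
      C.biUnion (fun a => (univ : Finset (Fin (sectorCount n₂))).filter (fun ω₂ : Fin (sectorCount n₂) =>
        ∃ δ : ℤ, |δ| ≤ 1 ∧ (sectorCount n₂ : ℤ) ∣ (((a : ℕ) : ℤ) - ((ω₂ : ℕ) : ℤ) - δ))) := by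
    intro ω₂ hω₂
    rw [Finset.mem_filter] at hω₂
    obtain ⟨k, h1, h2⟩ := hω₂.2
    obtain ⟨a, ha, hne⟩ := exists_fatNbr_of_bgmFatMultiplier_ne_zero e₀ β (nambuXiCT L μ K) n₂ ω₂ k h2
    have h1' := (support_klIsoFamily L M he β μ K m σ k h1).2.2
    rw [Finset.mem_biUnion]
    refine ⟨a, ?_, ?_⟩
    · rw [hC, Finset.mem_filter]; exact ⟨Finset.mem_univ _, momentumAngle L k.2, h1', hne⟩
    · rw [Finset.mem_filter]; exact ⟨Finset.mem_univ _, ha⟩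
  calc _ ≤ (C.biUnion (fun a => (univ : Finset (Fin (sectorCount n₂))).filter (fun ω₂ : Fin (sectorCount n₂) =>
        ∃ δ : ℤ, |δ| ≤ 1 ∧ (sectorCount n₂ : ℤ) ∣ (((a : ℕ) : ℤ) - ((ω₂ : ℕ) : ℤ) - δ)))).card := Finset.card_le_card hsub
    _ ≤ ∑ a ∈ C, ((univ : Finset (Fin (sectorCount n₂))).filter (fun ω₂ : Fin (sectorCount n₂) =>
        ∃ δ : ℤ, |δ| ≤ 1 ∧ (sectorCount n₂ : ℤ) ∣ (((a : ℕ) : ℤ) - ((ω₂ : ℕ) : ℤ) - δ))).card := Finset.card_biUnion_le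
    _ ≤ ∑ _a ∈ C, 3 := Finset.sum_le_sum fun a _ => card_fatNbrFin_symm_le_three n₂ a
    _ = C.card * 3 := by rw [Finset.sum_const, smul_eq_mul]
    _ ≤ 9 * 3 := Nat.mul_le_mul_right 3 hCcard
    _ = 27 := by norm_num

/-! ### §3 Character sums of the iso × thin and iso × fat symbols; the per-pair overlap sums -/

variable [NeZero M]

/-- **Iso × thin from the two SINGLE character sums** (Young's inequality on `(ℤ/2M) × (ℤ/L)²`): if the iso multiplier `iso_{m,σ}` has
character sum of `ℓ¹` norm `≤ Tᵢ` (`Tᵢ ≥ 0`) and the thin multiplier `thin_{n₂,a}` one of `ℓ¹` norm `≤ Tₐ`, then the product symbol has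
character sum of `ℓ¹` norm `≤ (2M·L²)⁻¹·Tᵢ·Tₐ`. [cite: BenfattoGiulianiMastropietro2006, §2.7 (2.71a)] -/
theorem charSum_klIso_klAniso_le_of_singles (β μ : ℝ) (K : TrigPolyC4v) (e₀ : ℝ) (m n₂ : ℕ) (σ : Fin (sectorCount (2 * m)))
    (a : Fin (sectorCount n₂)) {Ti Ta : ℝ} (hTi0 : 0 ≤ Ti)
    (hTi : ∑ z : TorusSite 1 (2 * M) × TorusSite 2 L,
      ‖∑ q : TorusSite 1 (2 * M) × TorusSite 2 L, (torusChar q.1 z.1 * torusChar q.2 z.2) •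
        klIsoFamily L M β μ K e₀ m σ (⟨(q.1 0).val, ZMod.val_lt (q.1 0)⟩, q.2)‖ ≤ Ti)
    (hTa : ∑ z : TorusSite 1 (2 * M) × TorusSite 2 L,
      ‖∑ q : TorusSite 1 (2 * M) × TorusSite 2 L, (torusChar q.1 z.1 * torusChar q.2 z.2) •
        klAnisoFamily L M β μ K e₀ n₂ a (⟨(q.1 0).val, ZMod.val_lt (q.1 0)⟩, q.2)‖ ≤ Ta) :
    ∑ z : TorusSite 1 (2 * M) × TorusSite 2 L,
      ‖∑ q : TorusSite 1 (2 * M) × TorusSite 2 L, (torusChar q.1 z.1 * torusChar q.2 z.2) •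
        (klIsoFamily L M β μ K e₀ m σ (⟨(q.1 0).val, ZMod.val_lt (q.1 0)⟩, q.2) *
          klAnisoFamily L M β μ K e₀ n₂ a (⟨(q.1 0).val, ZMod.val_lt (q.1 0)⟩, q.2))‖ ≤
      (((2 * M : ℕ) : ℝ) ^ 1 * (L : ℝ) ^ 2)⁻¹ * (Ti * Ta) := by
  have hG : (0 : ℝ) < (((2 * M : ℕ) : ℝ) ^ 1 * (L : ℝ) ^ 2) := by
    have h1 : (0 : ℝ) < ((2 * M : ℕ) : ℝ) := Nat.cast_pos.2 (Nat.pos_of_ne_zero (NeZero.ne (2 * M)))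
    have h2 : (0 : ℝ) < L := Nat.cast_pos.2 (Nat.pos_of_ne_zero (NeZero.ne L))
    positivity
  refine (sum_norm_prodCharSum_mul_le (d₁ := 1) (L₁ := 2 * M) (d₂ := 2) (L₂ := L) _ _).trans ?_
  exact mul_le_mul_of_nonneg_left (mul_le_mul hTi hTa (sum_nonneg fun z _ => norm_nonneg _) hTi0) (inv_nonneg.2 hG.le)

/-- **The iso × fat character sum is at most three iso × thin character sums**: if for every neighbour `a ∈ S_{ω₂}` the character
sum of `iso_{m,σ} · thin_{n₂,a}` has `ℓ¹` norm `≤ T` (`T ≥ 0`), then the character sum of `iso_{m,σ} · F̃_{n₂,ω₂}` has `ℓ¹` norm `≤ 3T`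
(`n₂ + 1 ≤ m`). [cite: BenfattoGiulianiMastropietro2006, §2.7 (2.66), (2.71a)] -/
theorem charSum_klIso_bgmFat_le {e₀ : ℝ} (he : 0 < e₀) (β μ : ℝ) (K : TrigPolyC4v) {m n₂ : ℕ} (hm : n₂ + 1 ≤ m)
    (σ : Fin (sectorCount (2 * m))) (ω₂ : Fin (sectorCount n₂)) {T : ℝ} (hT0 : 0 ≤ T)
    (hT : ∀ a : Fin (sectorCount n₂), ∑ z : TorusSite 1 (2 * M) × TorusSite 2 L,
      ‖∑ q : TorusSite 1 (2 * M) × TorusSite 2 L, (torusChar q.1 z.1 * torusChar q.2 z.2) •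
        (klIsoFamily L M β μ K e₀ m σ (⟨(q.1 0).val, ZMod.val_lt (q.1 0)⟩, q.2) *
          klAnisoFamily L M β μ K e₀ n₂ a (⟨(q.1 0).val, ZMod.val_lt (q.1 0)⟩, q.2))‖ ≤ T) :
    ∑ z : TorusSite 1 (2 * M) × TorusSite 2 L,
      ‖∑ q : TorusSite 1 (2 * M) × TorusSite 2 L, (torusChar q.1 z.1 * torusChar q.2 z.2) •
        (klIsoFamily L M β μ K e₀ m σ (⟨(q.1 0).val, ZMod.val_lt (q.1 0)⟩, q.2) *
          bgmFatMultiplier L M e₀ β (nambuXiCT L μ K) n₂ ω₂ (⟨(q.1 0).val, ZMod.val_lt (q.1 0)⟩, q.2))‖ ≤ 3 * T := by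
  set S := (univ : Finset (Fin (sectorCount n₂))).filter (fun a : Fin (sectorCount n₂) =>
      ∃ δ : ℤ, |δ| ≤ 1 ∧ (sectorCount n₂ : ℤ) ∣ (((a : ℕ) : ℤ) - ((ω₂ : ℕ) : ℤ) - δ)) with hS
  have hScard : S.card ≤ 3 := card_fatNbrFin_le_three n₂ (ω₂ : ℕ)
  simp_rw [klIsoFamily_mul_bgmFatMultiplier_eq_sum he β μ K hm σ ω₂]
  refine (sum_norm_charSum_sum_le S (fun a q => klIsoFamily L M β μ K e₀ m σ (⟨(q.1 0).val, ZMod.val_lt (q.1 0)⟩, q.2) *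
    klAnisoFamily L M β μ K e₀ n₂ a (⟨(q.1 0).val, ZMod.val_lt (q.1 0)⟩, q.2))).trans ?_
  calc _ ≤ ∑ _a ∈ S, T := Finset.sum_le_sum fun a _ => hT a
    _ = S.card * T := by rw [Finset.sum_const, nsmul_eq_mul]
    _ ≤ 3 * T := mul_le_mul_of_nonneg_right (by exact_mod_cast hScard) hT0

/-- **The per-pair position sums of the overlap kernel `E(klIsoFamily m)·S(F̃_{n₂})` from the two SINGLE character-sum bounds**
(`n₂ + 1 ≤ m`): if every iso multiplier of resolution `m` has character sum of `ℓ¹` norm `≤ Tᵢ` and every thin multiplier of index `n₂`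
one of `ℓ¹` norm `≤ Tₐ`, then for every label pair `(σ, ω₂)` (spin and charge matched) both the column sum (fine position summed) and the
row sum (coarse position summed) of `‖(E(iso m)S(F̃_{n₂}))((y,σ),(x,ω₂))‖` are `≤ 3·(2ML²)⁻¹·Tᵢ·Tₐ/(βL²)` (`β > 0`) — the `hcol₁`/`hrow₁`
inputs of `hubbardSectorPinnedSum_refine_le_of_plateau_pair`. [cite: BenfattoGiulianiMastropietro2006, §2.7 (2.71a)] -/
theorem overlap_pairSums_klIso_bgmFat_le_of_singles {e₀ β : ℝ} (he : 0 < e₀) (hβ : 0 < β) (μ : ℝ) (K : TrigPolyC4v) {m n₂ : ℕ}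
    (hm : n₂ + 1 ≤ m) {Ti Ta : ℝ} (hTi0 : 0 ≤ Ti) (hTa0 : 0 ≤ Ta)
    (hTi : ∀ σ : Fin (sectorCount (2 * m)), ∑ z : TorusSite 1 (2 * M) × TorusSite 2 L,
      ‖∑ q : TorusSite 1 (2 * M) × TorusSite 2 L, (torusChar q.1 z.1 * torusChar q.2 z.2) •
        klIsoFamily L M β μ K e₀ m σ (⟨(q.1 0).val, ZMod.val_lt (q.1 0)⟩, q.2)‖ ≤ Ti)
    (hTa : ∀ a : Fin (sectorCount n₂), ∑ z : TorusSite 1 (2 * M) × TorusSite 2 L,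
      ‖∑ q : TorusSite 1 (2 * M) × TorusSite 2 L, (torusChar q.1 z.1 * torusChar q.2 z.2) •
        klAnisoFamily L M β μ K e₀ n₂ a (⟨(q.1 0).val, ZMod.val_lt (q.1 0)⟩, q.2)‖ ≤ Ta) :
    (∀ (σ : Fin (sectorCount (2 * m))) (ω₂ : Fin (sectorCount n₂)) (s c : Fin 2) (y : SpaceTimeIdx L M),
      ∑ x : SpaceTimeIdx L M, ‖(sectorAnalysisMatrix L M β (klIsoFamily L M β μ K e₀ m) *
        sectorSubMatrix L M β (bgmFatMultiplier L M e₀ β (nambuXiCT L μ K) n₂)) (y, ((σ, s), c)) (x, ((ω₂, s), c))‖ ≤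
          3 * ((((2 * M : ℕ) : ℝ) ^ 1 * (L : ℝ) ^ 2)⁻¹ * (Ti * Ta)) / (β * (L : ℝ) ^ 2)) ∧
    (∀ (σ : Fin (sectorCount (2 * m))) (ω₂ : Fin (sectorCount n₂)) (s c : Fin 2) (x : SpaceTimeIdx L M),
      ∑ y : SpaceTimeIdx L M, ‖(sectorAnalysisMatrix L M β (klIsoFamily L M β μ K e₀ m) *
        sectorSubMatrix L M β (bgmFatMultiplier L M e₀ β (nambuXiCT L μ K) n₂)) (y, ((σ, s), c)) (x, ((ω₂, s), c))‖ ≤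
          3 * ((((2 * M : ℕ) : ℝ) ^ 1 * (L : ℝ) ^ 2)⁻¹ * (Ti * Ta)) / (β * (L : ℝ) ^ 2)) := by
  have hG : (0 : ℝ) < (((2 * M : ℕ) : ℝ) ^ 1 * (L : ℝ) ^ 2) := by
    have h1 : (0 : ℝ) < ((2 * M : ℕ) : ℝ) := Nat.cast_pos.2 (Nat.pos_of_ne_zero (NeZero.ne (2 * M)))
    have h2 : (0 : ℝ) < L := Nat.cast_pos.2 (Nat.pos_of_ne_zero (NeZero.ne L))
    positivity
  have hT0 : 0 ≤ (((2 * M : ℕ) : ℝ) ^ 1 * (L : ℝ) ^ 2)⁻¹ * (Ti * Ta) := by positivity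
  exact overlapKernel_sums_le_of_charSum_le hβ (klIsoFamily L M β μ K e₀ m)
    (bgmFatMultiplier L M e₀ β (nambuXiCT L μ K) n₂) (T := 3 * ((((2 * M : ℕ) : ℝ) ^ 1 * (L : ℝ) ^ 2)⁻¹ * (Ti * Ta)))
    (fun σ ω₂ => charSum_klIso_bgmFat_le he β μ K hm σ ω₂ hT0
      (fun a => charSum_klIso_klAniso_le_of_singles β μ K e₀ m n₂ σ a hTi0 (hTi σ) (hTa a)))

/-! ### §4 The iso single character sum from the `4M`-padded torus bound (`EngineV8.IsoTorusBoundAt`) -/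

/-- **The `(ℤ/2M) × (ℤ/L)²` character-sum `ℓ¹` norm is at most the `(ℤ/4M) × (ℤ/L)²`-padded one**, for ANY symbol `F` on the
frequency–momentum carrier: the displacements of the dual time lattice are the EVEN points `d = 2z₀` of `ℤ/4M`, on which the padded
character `χ^{(4M)}_{k₀}(2z₀) = χ^{(2M)}_{k₀}(z₀)` (`TorusBlock.torusChar_lift_eq_reduce`). [cite: BenfattoGiulianiMastropietro2006, §2.7 (2.71a)] -/
theorem charSum_l1_le_padded (F : FreqMomentum L M → ℂ) :
    ∑ z : TorusSite 1 (2 * M) × TorusSite 2 L,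
        ‖∑ q : TorusSite 1 (2 * M) × TorusSite 2 L, (torusChar q.1 z.1 * torusChar q.2 z.2) •
          F (⟨(q.1 0).val, ZMod.val_lt (q.1 0)⟩, q.2)‖ ≤
      ∑ dw : TorusSite 1 (2 * (2 * M)) × TorusSite 2 L,
        ‖∑ k : FreqMomentum L M, F k *
          (torusChar (fun _ : Fin 1 => ((k.1 : ℕ) : ZMod (2 * (2 * M)))) dw.1 * torusChar k.2 dw.2)‖ := by
  haveI : NeZero (2 * (2 * M)) := ⟨by have := NeZero.ne M; omega⟩
  -- the inner `2M`-sum as a sum over the frequency–momentum carrier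
  have hinner : ∀ z : TorusSite 1 (2 * M) × TorusSite 2 L,
      ∑ q : TorusSite 1 (2 * M) × TorusSite 2 L, (torusChar q.1 z.1 * torusChar q.2 z.2) •
          F (⟨(q.1 0).val, ZMod.val_lt (q.1 0)⟩, q.2) =
        ∑ k : FreqMomentum L M, F k * (torusChar (fun _ : Fin 1 => ((k.1 : ℕ) : ZMod (2 * M))) z.1 * torusChar k.2 z.2) := by
    intro z
    rw [← sum_freqMomentum_eq_sum_prodTorus (fun q : TorusSite 1 (2 * M) × TorusSite 2 L =>
      (torusChar q.1 z.1 * torusChar q.2 z.2) • F (⟨(q.1 0).val, ZMod.val_lt (q.1 0)⟩, q.2))]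
    refine sum_congr rfl fun k _ => ?_
    have hk : (⟨(((k.1 : ℕ) : ZMod (2 * M))).val, ZMod.val_lt _⟩ : MatsubaraIdx M) = k.1 := by
      apply Fin.ext
      simp only [ZMod.val_natCast]
      exact Nat.mod_eq_of_lt k.1.isLt
    simp only [smul_eq_mul, hk]
    ring
  -- the doubling embedding of the dual time lattice into `ℤ/4M`
  set ι : TorusSite 1 (2 * M) × TorusSite 2 L → TorusSite 1 (2 * (2 * M)) × TorusSite 2 L :=
    fun z => (fun j => ((2 * (z.1 j).val : ℕ) : ZMod (2 * (2 * M))), z.2) with hι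
  have hιinj : Function.Injective ι := by
    intro z z' h
    have h1 := congr_arg Prod.fst h
    have h2 := congr_arg Prod.snd h
    refine Prod.ext (funext fun j => ?_) h2
    have hj := congr_fun h1 j
    simp only [hι] at hj
    have hv := congr_arg ZMod.val hj
    rw [ZMod.val_natCast, ZMod.val_natCast, Nat.mod_eq_of_lt (by have := ZMod.val_lt (z.1 j); omega),
      Nat.mod_eq_of_lt (by have := ZMod.val_lt (z'.1 j); omega)] at hv
    exact ZMod.val_injective _ (by omega)
  -- at an embedded point the padded character sum IS the `2M` one
  have hat : ∀ z : TorusSite 1 (2 * M) × TorusSite 2 L,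
      ∑ k : FreqMomentum L M, F k *
          (torusChar (fun _ : Fin 1 => ((k.1 : ℕ) : ZMod (2 * (2 * M)))) (ι z).1 * torusChar k.2 (ι z).2) =
        ∑ k : FreqMomentum L M, F k * (torusChar (fun _ : Fin 1 => ((k.1 : ℕ) : ZMod (2 * M))) z.1 * torusChar k.2 z.2) := by
    intro z
    refine sum_congr rfl fun k _ => ?_
    have hlift := TorusBlock.torusChar_lift_eq_reduce (d := 1) (b := 2) (m := 2 * M) (M := 2 * (2 * M)) rfl
      (fun _ : Fin 1 => ((k.1 : ℕ) : ZMod (2 * (2 * M)))) z.1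
    have hred : (fun _ : Fin 1 => ((((k.1 : ℕ) : ZMod (2 * (2 * M)))).val : ZMod (2 * M))) =
        fun _ : Fin 1 => ((k.1 : ℕ) : ZMod (2 * M)) := by
      funext
      rw [ZMod.val_natCast, Nat.mod_eq_of_lt (by have := k.1.isLt; omega)]
    simp only [hι]
    rw [hlift, hred]
  calc ∑ z : TorusSite 1 (2 * M) × TorusSite 2 L,
        ‖∑ q : TorusSite 1 (2 * M) × TorusSite 2 L, (torusChar q.1 z.1 * torusChar q.2 z.2) •
          F (⟨(q.1 0).val, ZMod.val_lt (q.1 0)⟩, q.2)‖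
      = ∑ z : TorusSite 1 (2 * M) × TorusSite 2 L, ‖∑ k : FreqMomentum L M, F k *
          (torusChar (fun _ : Fin 1 => ((k.1 : ℕ) : ZMod (2 * (2 * M)))) (ι z).1 * torusChar k.2 (ι z).2)‖ := by
        refine sum_congr rfl fun z _ => ?_
        rw [hinner z, hat z]
    _ = ∑ dw ∈ (univ : Finset (TorusSite 1 (2 * M) × TorusSite 2 L)).image ι, ‖∑ k : FreqMomentum L M, F k *
          (torusChar (fun _ : Fin 1 => ((k.1 : ℕ) : ZMod (2 * (2 * M)))) dw.1 * torusChar k.2 dw.2)‖ := by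
        rw [Finset.sum_image fun z _ z' _ h => hιinj h]
    _ ≤ _ := Finset.sum_le_sum_of_subset_of_nonneg (Finset.subset_univ _) fun _ _ _ => norm_nonneg _

/-- **The iso single character sum from the padded torus bound**: if the inner statement of `EngineV8.IsoTorusBoundAt T` holds for the
iso multiplier `klIsoFamily … m σ` at charge `0` — `(1/(|β|L²))·Σ_{dw}‖Σ_k iso_{m,σ}(k)·χ^{(4M)}_{k₀}(d)χ_{k⃗}(w)‖ ≤ T / imagTimeWeight β M` —
then its `(ℤ/2M) × (ℤ/L)²` character sum has `ℓ¹` norm `≤ 2M·L²·T` (`β > 0`). [cite: BenfattoGiulianiMastropietro2006, §2.6 (2.81)] -/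
theorem charSum_klIso_single_le_of_padded {β : ℝ} (hβ : 0 < β) (μ : ℝ) (K : TrigPolyC4v) (e₀ : ℝ) (m : ℕ)
    (σ : Fin (sectorCount (2 * m))) {T : ℝ}
    (hT : 1 / (|β| * (L : ℝ) ^ 2) *
        ∑ dw : TorusSite 1 (2 * (2 * M)) × TorusSite 2 L, ‖∑ k : FreqMomentum L M, klIsoFamily L M β μ K e₀ m σ k *
          (torusChar (fun _ : Fin 1 => ((k.1 : ℕ) : ZMod (2 * (2 * M)))) dw.1 * torusChar k.2 dw.2)‖ ≤
      T / imagTimeWeight β M) :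
    ∑ z : TorusSite 1 (2 * M) × TorusSite 2 L,
      ‖∑ q : TorusSite 1 (2 * M) × TorusSite 2 L, (torusChar q.1 z.1 * torusChar q.2 z.2) •
        klIsoFamily L M β μ K e₀ m σ (⟨(q.1 0).val, ZMod.val_lt (q.1 0)⟩, q.2)‖ ≤ 2 * M * (L : ℝ) ^ 2 * T := by
  have hL : (0 : ℝ) < L := Nat.cast_pos.2 (Nat.pos_of_ne_zero (NeZero.ne L))
  have hM : (0 : ℝ) < M := Nat.cast_pos.2 (Nat.pos_of_ne_zero (NeZero.ne M))
  have hc : 0 < 1 / (|β| * (L : ℝ) ^ 2) := by rw [abs_of_pos hβ]; positivity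
  refine (charSum_l1_le_padded _).trans ?_
  set S := ∑ dw : TorusSite 1 (2 * (2 * M)) × TorusSite 2 L, ‖∑ k : FreqMomentum L M, klIsoFamily L M β μ K e₀ m σ k *
          (torusChar (fun _ : Fin 1 => ((k.1 : ℕ) : ZMod (2 * (2 * M)))) dw.1 * torusChar k.2 dw.2)‖ with hS
  have h1 : S ≤ T / imagTimeWeight β M / (1 / (|β| * (L : ℝ) ^ 2)) := (le_div_iff₀ hc).2 (by rw [mul_comm]; exact hT)
  refine h1.trans (le_of_eq ?_)
  rw [imagTimeWeight, abs_of_pos hβ]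
  field_simp

end Summit.HubbardSuperconductivity.HubbardSuperconductivity.Theorems.TorusFourierL2

end
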